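import Mathlib.Analysis.SpecialFunctions.Log.Basic
import Mathlib.GroupTheory.Perm.Fin
import Literature.Computability.AlgebraicComplexity.TPPGroupExtension
import HarnessLib

/-!
# Pseudo-exponent bounds: `α(G) > 2` and `α(G) ≤ max(α(N), α(G/N))` (Cohn–Umans 2003, Lemmas 3.1–3.2)

Topic `Literature/Computability/AlgebraicComplexity` (group-theoretic matrix multiplication), namespace
`Literature.Computability.AlgebraicComplexity`; companion of `CohnUmansTPP.lean` (`RealizesTPP`; the NON-strict
packing bounds `RealizesTPP.mul_le_card : nm ≤ |G|` and, for abelian `G`, `RealizesTPP.mul_mul_le_card :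
nmp ≤ |G|` are there) and `TPPGroupExtension.lean` (Lemma 2.1, permutations).

H. Cohn, C. Umans, *A group-theoretic approach to fast matrix multiplication*, FOCS 2003 = arXiv:math/0307321,
§3: Def. 3.1 ("The pseudo-exponent `α(G)` of a non-trivial finite group `G` is the minimum of `3 log|G| / log nmp`
over all `n,m,p` (not all `1`) such that `G` realizes `⟨n,m,p⟩`") and **Lemma 3.1** ("The pseudo-exponent of a
finite group `G` is always greater than `2` and at most `3`. If `G` is abelian, then it is exactly `3`."); printed
proof of the strict bound (Lemma 4 of the arXiv text, p. 5): "the map `(x,y) ↦ x⁻¹y` is injective on `S₁ × S₂` and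
its image intersects the quotient set `Q(S₃)` only in the identity. Thus, `|G| ≥ n₁n₂`, and `|G| > n₁n₂` unless
`n₃ = 1`. Similarly … Thus, `|G|³ > (n₁n₂n₃)²`, so `α(G) > 2`."  And the first example of §3: "the symmetric group
`S₃` … realizes `⟨2, 2, 2⟩` through its three subgroups of order `2`, so it has pseudo-exponent at most `log₂ 6`";
and **Lemma 3.2** ("If `N` is a normal subgroup of `G`, then `α(G) ≤ max(α(N), α(G/N))`", Lemma 5 of the arXiv
text; proof: Lemma 2.2 and `3 log|G| / log(n₁m₁n₂m₂n₃m₃) = (3 log|N| + 3 log|G/N|)/(log n₁n₂n₃ + log m₁m₂m₃)`,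
a mediant).

## Results (all proved; `α(G)` itself is not introduced — the statements are the inequalities it abbreviates)
* `RealizesTPP.mul_lt_card` — `nm < |G|` when `p ≥ 2`.  (The image of `(x,y) ↦ x⁻¹y` misses the element
  `s₀⁻¹ (u'u⁻¹) t₀` for any `u ≠ u'` in `S₃`: `x⁻¹y = s₀⁻¹ u'u⁻¹ t₀` is the TPP relation
  `s₀x⁻¹ · y t₀⁻¹ · u u'⁻¹ = 1`.  This is the precise form of "its image intersects `Q(S₃)` only in the identity",
  which as printed presumes `1 ∈ S₁ ∩ S₂`.)
* `CohnUmans2003_lemma31` — **`(nmp)² < |G|³`** for every realized `⟨n,m,p⟩` with `nmp > 1` ("`α(G) > 2`"), and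
  the logarithmic reading `CohnUmans2003_lemma31_log : 2 log(nmp) < 3 log|G|` (i.e. `3 log|G| / log(nmp) > 2`).
* `realizesTPP_perm_fin_three` — `S₃` realizes `⟨2,2,2⟩`.
* `CohnUmans2003_lemma32` — Lemma 3.2 in ratio form: if `N ⊴ G` realizes `⟨n₁,n₂,n₃⟩` with
  `3 log|N| ≤ a log(n₁n₂n₃)` and `G/N` realizes `⟨m₁,m₂,m₃⟩` with `3 log|G/N| ≤ a log(m₁m₂m₃)`, then `G` realizes
  `⟨n₁m₁, n₂m₂, n₃m₃⟩` and `3 log|G| ≤ a log(n₁m₁n₂m₂n₃m₃)` (so `α(G) ≤ max(α(N), α(G/N))`).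

## References
* H. Cohn, C. Umans, FOCS 2003, 438–449; arXiv:math/0307321, §3: Def. 3.1, Lemma 3.1, Lemma 3.2 and the `S₃`
  example (Def. 2, Lemmas 4–5 of the arXiv text, p. 5). [CohnUmans2003]
-/

namespace Literature.Computability.AlgebraicComplexity

variable {G : Type*} [Group G]

/-! ## Strict packing: `|G| > n₁n₂` unless `n₃ = 1` -/

/-- **Cohn–Umans 2003, Lemma 3.1 (proof), strict form**: if `G` realizes `⟨n, m, p⟩` with `p ≥ 2` then
`nm < |G|`: "the map `(x,y) ↦ x⁻¹y` is injective on `S₁ × S₂` … `|G| > n₁n₂` unless `n₃ = 1`" — for `u ≠ u'` in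
`S₃` and any `s₀ ∈ S₁`, `t₀ ∈ S₂` the element `s₀⁻¹ u'u⁻¹ t₀` is not of the form `x⁻¹y`.
[cite: CohnUmans2003, Lemma 3.1 (Lemma 4 of the arXiv text, p. 5)] -/
theorem RealizesTPP.mul_lt_card [Fintype G] {n m p : ℕ} (h : RealizesTPP G n m p) (hp : 2 ≤ p) :
    n * m < Fintype.card G := by
  classical
  obtain ⟨S, T, U, hS, hT, hU, hTPP⟩ := h
  -- trivial when `S` or `T` is empty
  rcases S.eq_empty_or_nonempty with hSe | ⟨s₀, hs₀⟩
  · subst hSe; simp only [Finset.card_empty] at hS; subst hS; simpa using Fintype.card_pos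
  rcases T.eq_empty_or_nonempty with hTe | ⟨t₀, ht₀⟩
  · subst hTe; simp only [Finset.card_empty] at hT; subst hT; simpa using Fintype.card_pos
  -- two distinct elements `u ≠ u'` of `U`
  obtain ⟨u, hu, u', hu', hne⟩ : ∃ u ∈ U, ∃ u' ∈ U, u ≠ u' :=
    Finset.one_lt_card.1 (by rw [hU]; exact hp)
  -- the injection `(x,y) ↦ x⁻¹y` on `S × T`
  let f : G × G → G := fun x => x.1⁻¹ * x.2
  have hinj : Set.InjOn f ↑(S ×ˢ T) := by
    rintro ⟨s, t⟩ hst ⟨s', t'⟩ hst' (he : s⁻¹ * t = s'⁻¹ * t')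
    simp only [Finset.coe_product, Set.mem_prod, Finset.mem_coe] at hst hst'
    have key : s' * s⁻¹ * (t * t'⁻¹) * (u * u⁻¹) = 1 := by
      rw [mul_inv_cancel, mul_one, mul_assoc, ← mul_assoc s⁻¹, he]; group
    obtain ⟨h1, h2, -⟩ := hTPP s' hst'.1 s hst.1 t hst.2 t' hst'.2 u hu u hu key
    exact Prod.ext h1.symm h2
  -- its image misses `g = s₀⁻¹ (u' u⁻¹) t₀`
  set g : G := s₀⁻¹ * (u' * u⁻¹) * t₀ with hg
  have hmiss : g ∉ (S ×ˢ T).image f := by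
    intro hmem
    obtain ⟨⟨s, t⟩, hst, he⟩ := Finset.mem_image.1 hmem
    rw [Finset.mem_product] at hst
    change s⁻¹ * t = g at he
    have key : s₀ * s⁻¹ * (t * t₀⁻¹) * (u * u'⁻¹) = 1 :=
      calc s₀ * s⁻¹ * (t * t₀⁻¹) * (u * u'⁻¹) = s₀ * (s⁻¹ * t) * t₀⁻¹ * (u * u'⁻¹) := by group
        _ = s₀ * g * t₀⁻¹ * (u * u'⁻¹) := by rw [he]
        _ = 1 := by rw [hg]; group
    obtain ⟨-, -, h3⟩ := hTPP s₀ hs₀ s hst.1 t hst.2 t₀ ht₀ u hu u' hu' key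
    exact hne h3
  have hsub : (S ×ˢ T).image f ⊆ Finset.univ.erase g :=
    fun x hx => Finset.mem_erase.2 ⟨by rintro rfl; exact hmiss hx, Finset.mem_univ _⟩
  calc n * m = (S ×ˢ T).card := by rw [Finset.card_product, hS, hT]
    _ = ((S ×ˢ T).image f).card := (Finset.card_image_of_injOn hinj).symm
    _ ≤ (Finset.univ.erase g).card := Finset.card_le_card hsub
    _ < Fintype.card G := by
        rw [Finset.card_erase_of_mem (Finset.mem_univ _), Finset.card_univ]
        exact Nat.sub_lt Fintype.card_pos one_pos

/-! ## Lemma 3.1: `α(G) > 2` -/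

/-- The case "third set has `≥ 2` elements" of Lemma 3.1: `(nmp)² = (nm)(mp)(pn) < |G|³`.
[cite: CohnUmans2003, Lemma 3.1 (Lemma 4 of the arXiv text, p. 5)] -/
private theorem sq_lt_cube_of_two_le [Fintype G] {n m p : ℕ} (h : RealizesTPP G n m p)
    (hn : 0 < n) (hm : 0 < m) (hp : 2 ≤ p) : (n * m * p) ^ 2 < Fintype.card G ^ 3 := by
  have h12 : n * m < Fintype.card G := h.mul_lt_card hp
  have h23 : m * p ≤ Fintype.card G := h.rotate.mul_le_card hn.ne'
  have h31 : p * n ≤ Fintype.card G := h.rotate.rotate.mul_le_card hm.ne'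
  have hbc : m * p * (p * n) ≤ Fintype.card G * Fintype.card G := Nat.mul_le_mul h23 h31
  have hpos : 0 < m * p * (p * n) := by positivity
  calc (n * m * p) ^ 2 = n * m * (m * p * (p * n)) := by ring
    _ < Fintype.card G * (m * p * (p * n)) := Nat.mul_lt_mul_of_pos_right h12 hpos
    _ ≤ Fintype.card G * (Fintype.card G * Fintype.card G) := Nat.mul_le_mul_left _ hbc
    _ = Fintype.card G ^ 3 := by ring

/-- **Cohn–Umans 2003, Lemma 3.1 ("the pseudo-exponent of a finite group is always greater than `2`")**: if `G`
realizes `⟨n, m, p⟩` with `nmp > 1` then `(nmp)² < |G|³` — "`|G| ≥ n₁n₂`, and `|G| > n₁n₂` unless `n₃ = 1`.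
Similarly, `|G| ≥ n₂n₃` with equality only if `n₁ = 1`, and `|G| ≥ n₁n₃` with equality only if `n₂ = 1`. Thus,
`|G|³ > (n₁n₂n₃)²`" (the permuted bounds via Lemma 2.1). The upper bound `α ≤ 3` is `realizesTPP_one_one_card`,
the abelian equality is `RealizesTPP.mul_mul_le_card` (`CohnUmansTPP.lean`).
[cite: CohnUmans2003, Lemma 3.1 (Lemma 4 of the arXiv text, p. 5)] -/
theorem CohnUmans2003_lemma31 [Fintype G] {n m p : ℕ} (h : RealizesTPP G n m p) (h1 : 1 < n * m * p) :
    (n * m * p) ^ 2 < Fintype.card G ^ 3 := by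
  have hn : 0 < n := Nat.pos_of_ne_zero fun h0 => by simp [h0] at h1
  have hm : 0 < m := Nat.pos_of_ne_zero fun h0 => by simp [h0] at h1
  have hp : 0 < p := Nat.pos_of_ne_zero fun h0 => by simp [h0] at h1
  -- one of `n, m, p` is `≥ 2`
  by_cases hp2 : 2 ≤ p
  · exact sq_lt_cube_of_two_le h hn hm hp2
  by_cases hn2 : 2 ≤ n
  · have := sq_lt_cube_of_two_le h.rotate hm hp hn2
    calc (n * m * p) ^ 2 = (m * p * n) ^ 2 := by ring
      _ < Fintype.card G ^ 3 := this
  by_cases hm2 : 2 ≤ m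
  · have := sq_lt_cube_of_two_le h.rotate.rotate hp hn hm2
    calc (n * m * p) ^ 2 = (p * n * m) ^ 2 := by ring
      _ < Fintype.card G ^ 3 := this
  exfalso
  have hn1 : n = 1 := by omega
  have hm1 : m = 1 := by omega
  have hp1 : p = 1 := by omega
  subst hn1 hm1 hp1
  simp at h1

/-- Lemma 3.1 in the logarithmic form of Def. 3.1: `2 log(nmp) < 3 log|G|`, i.e. `3 log|G| / log(nmp) > 2` for
every realized `⟨n,m,p⟩` with `nmp > 1`. [cite: CohnUmans2003, Lemma 3.1 (Lemma 4 of the arXiv text, p. 5)] -/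
theorem CohnUmans2003_lemma31_log [Fintype G] {n m p : ℕ} (h : RealizesTPP G n m p) (h1 : 1 < n * m * p) :
    2 * Real.log ((n * m * p : ℕ) : ℝ) < 3 * Real.log (Fintype.card G) := by
  have key := CohnUmans2003_lemma31 h h1
  have hpos : (0 : ℝ) < ((n * m * p : ℕ) : ℝ) := by exact_mod_cast (lt_trans zero_lt_one h1)
  have hr : (((n * m * p : ℕ) : ℝ)) ^ 2 < (Fintype.card G : ℝ) ^ 3 := by exact_mod_cast key
  have := Real.log_lt_log (by positivity) hr
  rwa [Real.log_pow, Real.log_pow] at this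

/-! ## The first non-abelian example: `S₃` realizes `⟨2,2,2⟩` -/

/-- "The smallest example is the symmetric group `S₃` on `3` elements. It realizes `⟨2, 2, 2⟩` through its three
subgroups of order `2`" (`{1,(0 1)}`, `{1,(0 2)}`, `{1,(1 2)}`; so `α(S₃) ≤ log₂ 6`).
[cite: CohnUmans2003, §3 (example after Lemma 3.2; p. 5 of the arXiv text)] -/
theorem realizesTPP_perm_fin_three : RealizesTPP (Equiv.Perm (Fin 3)) 2 2 2 := by
  refine ⟨{1, Equiv.swap 0 1}, {1, Equiv.swap 0 2}, {1, Equiv.swap 1 2}, by decide, by decide, by decide, ?_⟩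
  decide

/-! ## Lemma 3.2: extensions -/

/-- **Cohn–Umans 2003, Lemma 3.2 ("If `N` is a normal subgroup of `G`, then `α(G) ≤ max(α(N), α(G/N))`")**, in
ratio form: realizations of `N` and `G/N` whose Def.-3.1 ratios are both `≤ a` combine (Lemma 2.2) to a
realization of `G` with ratio `≤ a`, because `|G| = |N|·|G/N|` and "`3 log|G| / log n₁m₁n₂m₂n₃m₃ =
(3 log|N| + 3 log|G/N|)/(log n₁n₂n₃ + log m₁m₂m₃)`, which is bounded above by the larger of" the two ratios.
[cite: CohnUmans2003, Lemma 3.2 (Lemma 5 of the arXiv text, p. 5)] -/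
theorem CohnUmans2003_lemma32 [Finite G] (N : Subgroup G) [N.Normal] {n₁ n₂ n₃ m₁ m₂ m₃ : ℕ} {a : ℝ}
    (hN : RealizesTPP N n₁ n₂ n₃) (hQ : RealizesTPP (G ⧸ N) m₁ m₂ m₃)
    (hn : 0 < n₁ * n₂ * n₃) (hm : 0 < m₁ * m₂ * m₃)
    (haN : 3 * Real.log (Nat.card N) ≤ a * Real.log ((n₁ * n₂ * n₃ : ℕ) : ℝ))
    (haQ : 3 * Real.log (Nat.card (G ⧸ N)) ≤ a * Real.log ((m₁ * m₂ * m₃ : ℕ) : ℝ)) :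
    RealizesTPP G (n₁ * m₁) (n₂ * m₂) (n₃ * m₃) ∧
      3 * Real.log (Nat.card G) ≤ a * Real.log ((n₁ * m₁ * (n₂ * m₂) * (n₃ * m₃) : ℕ) : ℝ) := by
  refine ⟨CohnUmans2003_lemma22 N hN hQ, ?_⟩
  have hcard : (Nat.card G : ℝ) = Nat.card (G ⧸ N) * Nat.card N := by
    exact_mod_cast Subgroup.card_eq_card_quotient_mul_card_subgroup N
  have hNpos : (0 : ℝ) < Nat.card N := by exact_mod_cast Nat.card_pos
  have hQpos : (0 : ℝ) < Nat.card (G ⧸ N) := by exact_mod_cast Nat.card_pos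
  have hnr : (0 : ℝ) < ((n₁ * n₂ * n₃ : ℕ) : ℝ) := by exact_mod_cast hn
  have hmr : (0 : ℝ) < ((m₁ * m₂ * m₃ : ℕ) : ℝ) := by exact_mod_cast hm
  have e : ((n₁ * m₁ * (n₂ * m₂) * (n₃ * m₃) : ℕ) : ℝ) =
      ((n₁ * n₂ * n₃ : ℕ) : ℝ) * ((m₁ * m₂ * m₃ : ℕ) : ℝ) := by
    push_cast; ring
  rw [hcard, Real.log_mul hQpos.ne' hNpos.ne', e, Real.log_mul hnr.ne' hmr.ne']
  linarith

end Literature.Computability.AlgebraicComplexity
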